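import Summits.NavierStokesRegularity.FunctionalMining.LatticeCounting
import Literature.Analysis.FunctionSpaces.TorusLatticeProductLaw
import Literature.Barriers.CriticalPhenomena.LaceExpansionXSpaceMiddleFactor
import HarnessLib

/-!
# FunctionalMining — the lattice trilinear estimate on `ℤ³`, one frequency region

Search for candidate a priori estimates; no regularity claim. Cell `pub-nsfunc`, prove seat
(gen 12). Second file of the lattice trilinear estimate behind the rows `EF.s | T_LD | G1`. For
nonnegative families `a, b, c : ℤ³ → [0, ∞]` and the spectral weights `σ_t(m) = (4π²|m|²)^t`
(`fracSymbol t m`, `μ_m = σ_1(m)`) consider the part of the trilinear convolution form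
`∑_{p, q} a(p) b(q) c(p + q)` where `q` is the SMALLEST of the three frequencies `p, q, p + q`:

`R = {(p, q) : p ≠ 0, q ≠ 0, μ_q ≤ μ_p, μ_q ≤ μ_{p+q}}`.

**Region lemma** (`sq_tsum_region_le`): for `t₂ < 3/2` and `t₁ + t₂ + t₃ = 3/2`,

`(∑_{(p,q) ∈ R} a(p) b(q) c(p+q))² ≤ K (∑ σ_{t₁} a²)(∑ σ_{t₂} b²)(∑ σ_{t₃} c²)`.

Proof: Cauchy–Schwarz on `ℤ³ × ℤ³` with `X = (σ_{t₁}(p)σ_{t₂}(q))^{1/2} a(p) b(q)` and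
`Y = 1_R (σ_{t₁}(p)σ_{t₂}(q))^{-1/2} c(p+q)`; on `R` the two large frequencies are comparable
(`μ_p ≤ 4μ_{p+q} ≤ 16μ_p`, parallelogram law), so `σ_{-t₁}(p) ≤ 4^{|t₁|} σ_{-t₁}(p+q)`; after the
shift `p ↦ p + q` the inner sum is the truncated Riesz sum `∑_{q ≠ 0, μ_q ≤ μ_r} μ_q^{-t₂} ≤ K μ_r^{3/2-t₂}`
(`LatticeCounting`), and `μ_r^{-t₁ + 3/2 - t₂} = σ_{t₃}(r)`. This is the lattice form of the
frequency-localised proof of the Sobolev product laws `H^{s₁}·H^{s₂} ⊂ H^{s₁+s₂-3/2}` (all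
`sᵢ < 3/2`, `s₁ + s₂ > 0`; Bahouri–Chemin–Danchin 2011, Cor. 2.55, Fourier majorants in place of
paraproducts). The other two regions follow by symmetry in the next file.
-/

noncomputable section

open MeasureTheory Set Filter Topology Real
open scoped ENNReal NNReal

namespace Summit.NavierStokesRegularity.FunctionalMining

namespace LatticeTrilinear

open Literature.Analysis.FunctionSpaces.Torus Literature.Analysis.FluidPDE.Torus
open Literature.Analysis.FunctionSpaces (Lattice.freqNormSq_le_two_mul_add)

variable {d : Type*} [Fintype d]

/-! ## 1. Geometry of the region: the two large frequencies are comparable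

(Cauchy–Schwarz for `ℝ≥0∞`-valued families on a product index set is the tree's
`Literature.Barriers.CriticalPhenomena.ennreal_sq_tsum_mul_le`.) -/

/-- `μ_{p+q} ≤ 4 μ_p` when `μ_q ≤ μ_p` (parallelogram law). [folklore] -/
theorem fracSymbol_one_add_le {p q : d → ℤ} (h : fracSymbol 1 q ≤ fracSymbol 1 p) :
    fracSymbol 1 (p + q) ≤ 4 * fracSymbol 1 p := by
  simp only [fracSymbol_one] at h ⊢
  have hpar := Lattice.freqNormSq_le_two_mul_add (p + q) q
  rw [add_sub_cancel_right] at hpar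
  have hπ : (0 : ℝ) ≤ 4 * π ^ 2 := by positivity
  nlinarith [mul_le_mul_of_nonneg_left hpar hπ]

/-- `μ_p ≤ 4 μ_{p+q}` when `μ_q ≤ μ_{p+q}` (parallelogram law). [folklore] -/
theorem fracSymbol_one_le_add {p q : d → ℤ} (h : fracSymbol 1 q ≤ fracSymbol 1 (p + q)) :
    fracSymbol 1 p ≤ 4 * fracSymbol 1 (p + q) := by
  simp only [fracSymbol_one] at h ⊢
  have hpar := Lattice.freqNormSq_le_two_mul_add p (p + q)
  rw [sub_add_cancel_left, freqNormSq_neg] at hpar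
  have hπ : (0 : ℝ) ≤ 4 * π ^ 2 := by positivity
  nlinarith [mul_le_mul_of_nonneg_left hpar hπ]

/-- **Transfer of a weight between comparable frequencies**: on the region
(`p ≠ 0`, `μ_q ≤ μ_p`, `μ_q ≤ μ_{p+q}`, `q ≠ 0`), `σ_{-t}(p) ≤ 4^{|t|} σ_{-t}(p + q)` for every real `t`.
[folklore] -/
theorem fracSymbol_neg_le_of_region {p q : d → ℤ} (hp : p ≠ 0) (hq : q ≠ 0)
    (h1 : fracSymbol 1 q ≤ fracSymbol 1 p) (h2 : fracSymbol 1 q ≤ fracSymbol 1 (p + q)) (t : ℝ) :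
    fracSymbol (-t) p ≤ (4 : ℝ) ^ |t| * fracSymbol (-t) (p + q) := by
  have hμp : 0 < fracSymbol 1 p := fracSymbol_one_pos hp
  have hμr : 0 < fracSymbol 1 (p + q) := lt_of_lt_of_le (fracSymbol_one_pos hq) h2
  have hA := fracSymbol_one_add_le h1
  have hB := fracSymbol_one_le_add h2
  rw [fracSymbol_eq_rpow (-t) p, fracSymbol_eq_rpow (-t) (p + q)]
  have h4 : (1 : ℝ) ≤ 4 := by norm_num
  rcases le_or_gt 0 t with ht | ht
  · -- `t ≥ 0`: `μ_p ≥ μ_{p+q}/4`, exponent `-t ≤ 0`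
    have hle : fracSymbol 1 (p + q) / 4 ≤ fracSymbol 1 p := by rw [div_le_iff₀ (by norm_num)]; linarith
    calc fracSymbol 1 p ^ (-t) ≤ (fracSymbol 1 (p + q) / 4) ^ (-t) :=
          Real.rpow_le_rpow_of_nonpos (by positivity) hle (by linarith)
      _ = (4 : ℝ) ^ t * fracSymbol 1 (p + q) ^ (-t) := by
          rw [Real.div_rpow hμr.le (by norm_num), Real.rpow_neg (by norm_num : (0 : ℝ) ≤ 4), div_eq_mul_inv,
            inv_inv, mul_comm]
      _ ≤ (4 : ℝ) ^ |t| * fracSymbol 1 (p + q) ^ (-t) :=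
          mul_le_mul_of_nonneg_right (Real.rpow_le_rpow_of_exponent_le h4 (le_abs_self t))
            (Real.rpow_nonneg hμr.le _)
  · -- `t < 0`: `μ_p ≤ 4 μ_{p+q}`, exponent `-t > 0`
    calc fracSymbol 1 p ^ (-t) ≤ (4 * fracSymbol 1 (p + q)) ^ (-t) :=
          Real.rpow_le_rpow hμp.le hB (by linarith)
      _ = (4 : ℝ) ^ (-t) * fracSymbol 1 (p + q) ^ (-t) := Real.mul_rpow (by norm_num) hμr.le
      _ ≤ (4 : ℝ) ^ |t| * fracSymbol 1 (p + q) ^ (-t) :=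
          mul_le_mul_of_nonneg_right (Real.rpow_le_rpow_of_exponent_le h4 (neg_le_abs t))
            (Real.rpow_nonneg hμr.le _)

/-- `σ_t(m)⁻¹ = σ_{-t}(m)` off the origin. [folklore] -/
theorem fracSymbol_inv_eq {m : d → ℤ} (hm : m ≠ 0) (t : ℝ) : (fracSymbol t m)⁻¹ = fracSymbol (-t) m := by
  rw [fracSymbol_eq_rpow t, fracSymbol_eq_rpow (-t), Real.rpow_neg (fracSymbol_one_pos hm).le]

/-- `σ_t(m) > 0` off the origin. [folklore] -/
theorem fracSymbol_pos_of_ne_zero {m : d → ℤ} (hm : m ≠ 0) (t : ℝ) : 0 < fracSymbol t m := by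
  rw [fracSymbol_eq_rpow]; exact Real.rpow_pos_of_pos (fracSymbol_one_pos hm) _

/-! ## 2. The region `q` smallest and the region lemma -/

/-- **The inner sum of the region lemma**: for `t₂ < 3/2` and `t₁ + t₂ + t₃ = 3/2` there is `K ≥ 0`
with `∑_p ∑_q 1_R(p,q) σ_{-t₁}(p) σ_{-t₂}(q) c(p+q)² ≤ K ∑_r σ_{t₃}(r) c(r)²` for every
`c : ℤ³ → [0,∞]` (weight transfer `σ_{-t₁}(p) ≤ 4^{|t₁|}σ_{-t₁}(p+q)`, shift `p ↦ p + q`, truncated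
Riesz sum in `q`). [folklore] -/
theorem tsum_region_weight_le (hd : Fintype.card d = 3) {t₁ t₂ t₃ : ℝ} (ht₂ : t₂ < 3 / 2)
    (hsum : t₁ + t₂ + t₃ = 3 / 2) :
    ∃ K : ℝ, 0 ≤ K ∧ ∀ c : (d → ℤ) → ℝ≥0∞,
      ∑' p : d → ℤ, ∑' q : d → ℤ, {x : (d → ℤ) × (d → ℤ) | x.1 ≠ 0 ∧ x.2 ≠ 0 ∧ fracSymbol 1 x.2 ≤ fracSymbol 1 x.1 ∧
          fracSymbol 1 x.2 ≤ fracSymbol 1 (x.1 + x.2)}.indicator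
          (fun x => ENNReal.ofReal (fracSymbol (-t₁) x.1 * fracSymbol (-t₂) x.2) * c (x.1 + x.2) ^ 2) (p, q) ≤
        ENNReal.ofReal K * ∑' r : d → ℤ, ENNReal.ofReal (fracSymbol t₃ r) * c r ^ 2 := by
  set R : Set ((d → ℤ) × (d → ℤ)) := {x : (d → ℤ) × (d → ℤ) | x.1 ≠ 0 ∧ x.2 ≠ 0 ∧ fracSymbol 1 x.2 ≤ fracSymbol 1 x.1 ∧
          fracSymbol 1 x.2 ≤ fracSymbol 1 (x.1 + x.2)} with hR
  obtain ⟨K₀, hK₀, hJ⟩ := tsum_indicator_fracSymbol_le hd ht₂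
  refine ⟨(4 : ℝ) ^ |t₁| * K₀, by positivity, fun c => ?_⟩
  -- the majorant after the weight transfer, as a function of `(q, r)` with `r = p + q`
  set T : (d → ℤ) → (d → ℤ) → ℝ≥0∞ := fun q r =>
    ({m : d → ℤ | m ≠ 0 ∧ fracSymbol 1 m ≤ fracSymbol 1 r}).indicator
      (fun m => ENNReal.ofReal (fracSymbol (-t₂) m)) q *
      (ENNReal.ofReal (fracSymbol (-t₁) r) * c r ^ 2) with hT
  have hpt : ∀ p q, R.indicator
      (fun x => ENNReal.ofReal (fracSymbol (-t₁) x.1 * fracSymbol (-t₂) x.2) * c (x.1 + x.2) ^ 2) (p, q) ≤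
      ENNReal.ofReal ((4 : ℝ) ^ |t₁|) * T q (p + q) := by
    intro p q
    by_cases hx : (p, q) ∈ R
    · obtain ⟨hp, hq, h1, h2⟩ := hx
      dsimp only at hp hq h1 h2
      have hmem : q ∈ {m : d → ℤ | m ≠ 0 ∧ fracSymbol 1 m ≤ fracSymbol 1 (p + q)} := ⟨hq, h2⟩
      rw [indicator_of_mem (show (p, q) ∈ R from ⟨hp, hq, h1, h2⟩)]
      simp only [hT, indicator_of_mem hmem]
      have hw := fracSymbol_neg_le_of_region hp hq h1 h2 t₁
      have h0 : 0 ≤ fracSymbol (-t₂) q := fracSymbol_nonneg _ _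
      have h4 : (0 : ℝ) ≤ (4 : ℝ) ^ |t₁| := by positivity
      have h4' : (0 : ℝ) ≤ (4 : ℝ) ^ |t₁| * fracSymbol (-t₁) (p + q) := mul_nonneg h4 (fracSymbol_nonneg _ _)
      calc ENNReal.ofReal (fracSymbol (-t₁) p * fracSymbol (-t₂) q) * c (p + q) ^ 2
          ≤ ENNReal.ofReal ((4 : ℝ) ^ |t₁| * fracSymbol (-t₁) (p + q) * fracSymbol (-t₂) q) * c (p + q) ^ 2 :=
            mul_le_mul' (ENNReal.ofReal_le_ofReal (mul_le_mul_of_nonneg_right hw h0)) le_rfl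
        _ = ENNReal.ofReal ((4 : ℝ) ^ |t₁|) * (ENNReal.ofReal (fracSymbol (-t₂) q) *
              (ENNReal.ofReal (fracSymbol (-t₁) (p + q)) * c (p + q) ^ 2)) := by
            rw [ENNReal.ofReal_mul h4', ENNReal.ofReal_mul h4]
            ring
    · rw [indicator_of_notMem hx]; exact zero_le
  -- the inner sum in `q` for fixed `r`
  have hinner : ∀ r, ∑' q, T q r ≤ ENNReal.ofReal K₀ * (ENNReal.ofReal (fracSymbol t₃ r) * c r ^ 2) := by
    intro r
    rw [hT]
    dsimp only
    rw [ENNReal.tsum_mul_right]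
    by_cases hr : r = 0
    · -- empty truncation: `μ_q ≤ μ_0 = 0` forces `q = 0`
      have h0 : ∀ q, ({m : d → ℤ | m ≠ 0 ∧ fracSymbol 1 m ≤ fracSymbol 1 r}).indicator
          (fun m => ENNReal.ofReal (fracSymbol (-t₂) m)) q = 0 := by
        intro q
        refine indicator_of_notMem (fun hq => ?_) _
        have := one_le_fracSymbol_one hq.1
        rw [hr, fracSymbol_zero one_ne_zero] at hq
        linarith [hq.2]
      rw [tsum_congr h0, tsum_zero, zero_mul]
      exact zero_le
    · have hμ : 0 < fracSymbol 1 r := fracSymbol_one_pos hr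
      calc (∑' q, ({m : d → ℤ | m ≠ 0 ∧ fracSymbol 1 m ≤ fracSymbol 1 r}).indicator
              (fun m => ENNReal.ofReal (fracSymbol (-t₂) m)) q) *
            (ENNReal.ofReal (fracSymbol (-t₁) r) * c r ^ 2)
          ≤ ENNReal.ofReal (K₀ * fracSymbol 1 r ^ (3 / 2 - t₂)) *
              (ENNReal.ofReal (fracSymbol (-t₁) r) * c r ^ 2) := mul_le_mul' (hJ _ hμ) le_rfl
        _ = ENNReal.ofReal K₀ * (ENNReal.ofReal (fracSymbol t₃ r) * c r ^ 2) := by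
            rw [ENNReal.ofReal_mul hK₀, mul_assoc, ← mul_assoc (ENNReal.ofReal (fracSymbol 1 r ^ (3 / 2 - t₂))),
              ← ENNReal.ofReal_mul (Real.rpow_nonneg hμ.le _), ← fracSymbol_eq_rpow,
              ← fracSymbol_add_of_ne_zero hr, show 3 / 2 - t₂ + -t₁ = t₃ by linarith]
  calc ∑' p, ∑' q, R.indicator
        (fun x => ENNReal.ofReal (fracSymbol (-t₁) x.1 * fracSymbol (-t₂) x.2) * c (x.1 + x.2) ^ 2) (p, q)
      ≤ ∑' p, ∑' q, ENNReal.ofReal ((4 : ℝ) ^ |t₁|) * T q (p + q) :=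
        ENNReal.tsum_le_tsum fun p => ENNReal.tsum_le_tsum fun q => hpt p q
    _ = ENNReal.ofReal ((4 : ℝ) ^ |t₁|) * ∑' q, ∑' p, T q (p + q) := by
        rw [ENNReal.tsum_comm, ← ENNReal.tsum_mul_left]
        exact tsum_congr fun q => ENNReal.tsum_mul_left
    _ = ENNReal.ofReal ((4 : ℝ) ^ |t₁|) * ∑' q, ∑' r, T q r := by
        congr 1
        exact tsum_congr fun q => (Equiv.addRight q).tsum_eq (T q)
    _ = ENNReal.ofReal ((4 : ℝ) ^ |t₁|) * ∑' r, ∑' q, T q r := by rw [ENNReal.tsum_comm]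
    _ ≤ ENNReal.ofReal ((4 : ℝ) ^ |t₁|) * ∑' r, ENNReal.ofReal K₀ * (ENNReal.ofReal (fracSymbol t₃ r) * c r ^ 2) :=
        mul_le_mul' le_rfl (ENNReal.tsum_le_tsum hinner)
    _ = ENNReal.ofReal ((4 : ℝ) ^ |t₁| * K₀) * ∑' r, ENNReal.ofReal (fracSymbol t₃ r) * c r ^ 2 := by
        rw [ENNReal.tsum_mul_left, ← mul_assoc, ← ENNReal.ofReal_mul (by positivity)]

/-- **Region lemma of the lattice trilinear estimate on `ℤ³`.** For `t₂ < 3/2` and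
`t₁ + t₂ + t₃ = 3/2` there is `K ≥ 0` such that for all `a b c : ℤ³ → [0, ∞]`,
`(∑_{(p,q) ∈ R} a(p) b(q) c(p+q))² ≤ K (∑ σ_{t₁} a²) (∑ σ_{t₂} b²) (∑ σ_{t₃} c²)`, where
`R` = the region `q` smallest (`p ≠ 0`, `q ≠ 0`, `μ_q ≤ μ_p`, `μ_q ≤ μ_{p+q}`) and `σ_t(m) = (4π²|m|²)^t`. [folklore;
Bahouri–Chemin–Danchin 2011, Cor. 2.55, lattice/Fourier-majorant form] -/
theorem sq_tsum_region_le (hd : Fintype.card d = 3) {t₁ t₂ t₃ : ℝ} (ht₂ : t₂ < 3 / 2)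
    (hsum : t₁ + t₂ + t₃ = 3 / 2) :
    ∃ K : ℝ, 0 ≤ K ∧ ∀ a b c : (d → ℤ) → ℝ≥0∞,
      (∑' p : d → ℤ, ∑' q : d → ℤ, {x : (d → ℤ) × (d → ℤ) | x.1 ≠ 0 ∧ x.2 ≠ 0 ∧ fracSymbol 1 x.2 ≤ fracSymbol 1 x.1 ∧
          fracSymbol 1 x.2 ≤ fracSymbol 1 (x.1 + x.2)}.indicator
          (fun x => a x.1 * b x.2 * c (x.1 + x.2)) (p, q)) ^ 2 ≤
        ENNReal.ofReal K * (∑' m, ENNReal.ofReal (fracSymbol t₁ m) * a m ^ 2) *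
          (∑' m, ENNReal.ofReal (fracSymbol t₂ m) * b m ^ 2) *
          (∑' m, ENNReal.ofReal (fracSymbol t₃ m) * c m ^ 2) := by
  obtain ⟨K, hK, hW⟩ := tsum_region_weight_le hd ht₂ hsum
  set R : Set ((d → ℤ) × (d → ℤ)) := {x : (d → ℤ) × (d → ℤ) | x.1 ≠ 0 ∧ x.2 ≠ 0 ∧ fracSymbol 1 x.2 ≤ fracSymbol 1 x.1 ∧
          fracSymbol 1 x.2 ≤ fracSymbol 1 (x.1 + x.2)} with hR
  refine ⟨K, hK, fun a b c => ?_⟩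
  -- the two Cauchy–Schwarz factors on `ℤ³ × ℤ³`
  set X : (d → ℤ) × (d → ℤ) → ℝ≥0∞ := fun x =>
    ENNReal.ofReal (Real.sqrt (fracSymbol t₁ x.1 * fracSymbol t₂ x.2)) * (a x.1 * b x.2) with hX
  set Y : (d → ℤ) × (d → ℤ) → ℝ≥0∞ := fun x => R.indicator
    (fun x => ENNReal.ofReal (Real.sqrt (fracSymbol t₁ x.1 * fracSymbol t₂ x.2))⁻¹ * c (x.1 + x.2)) x with hY
  -- termwise `X Y = 1_R a b c`
  have hXY : ∀ x, X x * Y x = R.indicator (fun x => a x.1 * b x.2 * c (x.1 + x.2)) x := by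
    intro x
    by_cases hx : x ∈ R
    · simp only [hX, hY, indicator_of_mem hx]
      have hpos : 0 < Real.sqrt (fracSymbol t₁ x.1 * fracSymbol t₂ x.2) :=
        Real.sqrt_pos.2 (mul_pos (fracSymbol_pos_of_ne_zero hx.1 _) (fracSymbol_pos_of_ne_zero hx.2.1 _))
      calc ENNReal.ofReal (Real.sqrt (fracSymbol t₁ x.1 * fracSymbol t₂ x.2)) * (a x.1 * b x.2) *
            (ENNReal.ofReal (Real.sqrt (fracSymbol t₁ x.1 * fracSymbol t₂ x.2))⁻¹ * c (x.1 + x.2))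
          = (ENNReal.ofReal (Real.sqrt (fracSymbol t₁ x.1 * fracSymbol t₂ x.2)) *
              ENNReal.ofReal (Real.sqrt (fracSymbol t₁ x.1 * fracSymbol t₂ x.2))⁻¹) *
              (a x.1 * b x.2 * c (x.1 + x.2)) := by ring
        _ = a x.1 * b x.2 * c (x.1 + x.2) := by
            rw [← ENNReal.ofReal_mul (Real.sqrt_nonneg _), mul_inv_cancel₀ hpos.ne', ENNReal.ofReal_one, one_mul]
    · simp only [hY, indicator_of_notMem hx, mul_zero]
  -- `∑ X² = (∑ σ_{t₁} a²)(∑ σ_{t₂} b²)`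
  have hX2 : ∑' x, X x ^ 2 = (∑' m, ENNReal.ofReal (fracSymbol t₁ m) * a m ^ 2) *
      ∑' m, ENNReal.ofReal (fracSymbol t₂ m) * b m ^ 2 := by
    rw [Literature.Analysis.FunctionSpaces.Lattice.ennreal_tsum_mul_tsum, ENNReal.tsum_prod']
    refine tsum_congr fun p => tsum_congr fun q => ?_
    rw [hX]
    dsimp only
    rw [mul_pow, ← ENNReal.ofReal_pow (Real.sqrt_nonneg _),
      Real.sq_sqrt (mul_nonneg (fracSymbol_nonneg _ _) (fracSymbol_nonneg _ _)),
      ENNReal.ofReal_mul (fracSymbol_nonneg _ _)]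
    ring
  -- `∑ Y² ≤ K ∑ σ_{t₃} c²`
  have hY2 : ∑' x, Y x ^ 2 ≤ ENNReal.ofReal K * ∑' r, ENNReal.ofReal (fracSymbol t₃ r) * c r ^ 2 := by
    rw [ENNReal.tsum_prod']
    refine le_trans (le_of_eq (tsum_congr fun p => tsum_congr fun q => ?_)) (hW c)
    by_cases hx : (p, q) ∈ R
    · simp only [hY, indicator_of_mem hx]
      have h1 : 0 < fracSymbol t₁ p := fracSymbol_pos_of_ne_zero hx.1 _
      have h2 : 0 < fracSymbol t₂ q := fracSymbol_pos_of_ne_zero hx.2.1 _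
      have hpos : 0 < Real.sqrt (fracSymbol t₁ p * fracSymbol t₂ q) := Real.sqrt_pos.2 (mul_pos h1 h2)
      have hreal : (Real.sqrt (fracSymbol t₁ p * fracSymbol t₂ q))⁻¹ ^ 2 =
          fracSymbol (-t₁) p * fracSymbol (-t₂) q := by
        rw [inv_pow, Real.sq_sqrt (mul_pos h1 h2).le, mul_inv, fracSymbol_inv_eq hx.1, fracSymbol_inv_eq hx.2.1]
      rw [mul_pow, ← ENNReal.ofReal_pow (inv_nonneg.2 hpos.le), hreal]
    · simp only [hY, indicator_of_notMem hx, zero_pow two_ne_zero]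
  calc (∑' p, ∑' q, R.indicator (fun x => a x.1 * b x.2 * c (x.1 + x.2)) (p, q)) ^ 2
      = (∑' x, X x * Y x) ^ 2 := by rw [ENNReal.tsum_prod']; simp_rw [hXY]
    _ ≤ (∑' x, X x ^ 2) * ∑' x, Y x ^ 2 := Literature.Barriers.CriticalPhenomena.ennreal_sq_tsum_mul_le X Y
    _ ≤ ((∑' m, ENNReal.ofReal (fracSymbol t₁ m) * a m ^ 2) * ∑' m, ENNReal.ofReal (fracSymbol t₂ m) * b m ^ 2) *
          (ENNReal.ofReal K * ∑' r, ENNReal.ofReal (fracSymbol t₃ r) * c r ^ 2) := by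
        rw [hX2]; exact mul_le_mul' le_rfl hY2
    _ = _ := by ring

end LatticeTrilinear

end Summit.NavierStokesRegularity.FunctionalMining
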